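import Summits.Ventures.HodgeRepro2.T5SU11JacobiWeightDeriv
import Summits.Ventures.HodgeRepro2.T5SU11SphericalIntegral

/-!
# The law of the phase `log|a(g)|` under the Haar measure: density `2π e^{2s} ds` on `(0, ∞)`

The phase `s(g) = log|a(g)| = log cosh t(g)` of the Laplace form `(1 − |g·0|²)^{k/2} = e^{−k s(g)}`
(`T5SU11JacobiWeight`) is bi-`K`-invariant, so the spherical integration formula
`∫_G f dν = 2π ∫_0^∞ sinh t cosh t · f(a_t) dt` (`T5SU11SphericalIntegral.integral_nu_biRotInvariant`)
and the substitution `s = log cosh t` (`ds = tanh t dt`, so `sinh t cosh t dt = e^{2s} ds`;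
Mathlib's one-dimensional change of variables `lintegral_image_eq_lintegral_abs_deriv_mul`) give

  **`∫_G F(log|a(g)|) dν = 2π ∫_0^∞ F(s) e^{2s} ds`**

for every continuous `F ≥ 0` on `[0, ∞)` with `F ∘ log|a|` integrable (`integral_phase_eq`), i.e. the
push-forward of `ν` under the phase has density `2π e^{2s}` on `(0, ∞)`; tilting by `e^{−ks}`:
**`∫_G F(log|a(g)|) (1 − |g·0|²)^{k/2} dν = 2π ∫_0^∞ F(s) e^{−(k−2)s} ds`** (`integral_phase_mul_orbit_rpow`) —
under `m_k dν` the phase is exponentially distributed with rate `k − 2`. Cross-checks against the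
transform values computed by other routes: the mass `2π/(k − 2)` (`integral_orbit_rpow_nu`, row
`T5SU11JacobiIwasawa`) and the first moment `2π/(k − 2)²` of `T5SU11JacobiWeightDeriv`'s derivative
formula (`phase_law_mass`, `phase_law_first_moment`). Nothing is claimed about (N).

Blind lane: Mathlib + the HodgeRepro2 prefix only; no sorry; axioms ⊆ {propext, Classical.choice,
Quot.sound}.
-/

namespace Summit.Ventures.HodgeRepro2.T5SU11PhaseLaw

open MeasureTheory MeasureTheory.Measure Metric Set Filter Topology
open T5SU11Unimodular T5SU11Fibration T5SU11Cartan T5SU11CartanProjection T5HaarCircle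
  T5BergmanCoefficient T5SU11FibrationHaar T5SU11SphericalFunction T5SU11SphericalSymmetry
  T5SU11JacobiIwasawa T5SU11JacobiTransform T5SU11SphericalIntegral T5SU11JacobiWeight
  T5SU11JacobiWeightDeriv
open scoped Real ENNReal

/-! ### The phase in Cartan coordinates -/

/-- `|a(g)|` is bi-`K`-invariant. -/
lemma norm_mat_rot_mul_rot (u v : Circle) (g : SU11) :
    ‖mat (rot u * g * rot v) 0 0‖ = ‖mat g 0 0‖ := by
  rw [← cosh_cartanT, ← cosh_cartanT, cartanT_rot_mul_rot]

/-- `|a(a_t)| = cosh t` for `t ≥ 0`. -/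
lemma norm_mat_hyp {t : ℝ} (ht : 0 ≤ t) : ‖mat (hyp t) 0 0‖ = Real.cosh t := by
  rw [← cosh_cartanT, cartanT_hyp_of_nonneg ht]

/-! ### The substitution `s = log cosh t` -/

/-- `log ∘ cosh` maps `(0, ∞)` onto `(0, ∞)`. -/
lemma image_log_cosh_Ioi : (fun t => Real.log (Real.cosh t)) '' Ioi 0 = Ioi 0 := by
  ext s
  constructor
  · rintro ⟨t, ht, rfl⟩
    rw [mem_Ioi] at ht ⊢
    exact Real.log_pos (Real.one_lt_cosh.mpr ht.ne')
  · intro hs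
    rw [mem_Ioi] at hs
    have hcont : ContinuousOn (fun t => Real.log (Real.cosh t)) (Icc 0 (s + 1)) :=
      (Real.continuous_cosh.log fun t => (Real.cosh_pos t).ne').continuousOn
    have h0 : Real.log (Real.cosh 0) = 0 := by simp
    have hb : s ≤ Real.log (Real.cosh (s + 1)) := by
      rw [Real.le_log_iff_exp_le (Real.cosh_pos _), Real.cosh_eq, Real.exp_add]
      have h2 : (2 : ℝ) ≤ Real.exp 1 := by
        have := Real.add_one_le_exp (1 : ℝ)
        linarith
      have hs' : 0 < Real.exp s := Real.exp_pos s
      have hn : 0 ≤ Real.exp (-(s + 1)) := (Real.exp_pos _).le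
      nlinarith
    obtain ⟨t, ht, hts⟩ := intermediate_value_Icc (by linarith : (0 : ℝ) ≤ s + 1) hcont
      ⟨by rw [h0]; exact hs.le, hb⟩
    refine ⟨t, ?_, hts⟩
    rw [mem_Ioi]
    rcases ht.1.lt_or_eq with h | h
    · exact h
    · exfalso
      rw [← h] at hts
      simp only [Real.cosh_zero, Real.log_one] at hts
      linarith

/-- `log ∘ cosh` is injective on `(0, ∞)`. -/
lemma injOn_log_cosh_Ioi : InjOn (fun t => Real.log (Real.cosh t)) (Ioi 0) := by
  refine Real.log_injOn_pos.comp (Real.cosh_strictMonoOn.injOn.mono Ioi_subset_Ici_self) ?_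
  intro t _
  exact Real.cosh_pos t

/-- `(log ∘ cosh)' = sinh/cosh` (within `(0, ∞)`). -/
lemma hasDerivWithinAt_log_cosh (t : ℝ) :
    HasDerivWithinAt (fun t => Real.log (Real.cosh t)) (Real.sinh t / Real.cosh t) (Ioi 0) t :=
  ((Real.hasDerivAt_cosh t).log (Real.cosh_pos t).ne').hasDerivWithinAt

/-- **The substitution**: for `G ≥ 0` on `(0, ∞)`,
`∫⁻_{s>0} G(s) = ∫⁻_{t>0} (sinh t/cosh t) · G(log cosh t)`. -/
theorem lintegral_Ioi_comp_log_cosh (G : ℝ → ℝ≥0∞) :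
    ∫⁻ s in Ioi (0 : ℝ), G s
      = ∫⁻ t in Ioi (0 : ℝ), ENNReal.ofReal (|Real.sinh t / Real.cosh t|) * G (Real.log (Real.cosh t)) := by
  have key := lintegral_image_eq_lintegral_abs_deriv_mul (s := Ioi 0)
    (f := fun t => Real.log (Real.cosh t)) (f' := fun t => Real.sinh t / Real.cosh t) measurableSet_Ioi
    (fun t _ => hasDerivWithinAt_log_cosh t) injOn_log_cosh_Ioi G
  rwa [image_log_cosh_Ioi] at key

/-! ### The exponential moments -/

/-- **The mass**: `∫_0^∞ e^{−(k−2)s} ds = 1/(k − 2)` reproduces `∫_G m_k dν = 2π/(k − 2)` (`k > 2`). -/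
theorem phase_law_mass {k : ℝ} (hk : 2 < k) :
    2 * π * ∫ s in Ioi (0 : ℝ), Real.exp (-((k - 2) * s)) = 2 * π / (k - 2) := by
  have h := integral_exp_mul_Ioi (a := -(k - 2)) (by linarith) 0
  simp only [mul_zero, Real.exp_zero] at h
  have e : ∀ s : ℝ, Real.exp (-((k - 2) * s)) = Real.exp (-(k - 2) * s) := fun s => by ring_nf
  simp_rw [e, h]
  have hk2 : k - 2 ≠ 0 := by
    intro h0
    linarith
  field_simp

/-- **The first moment**: `2π ∫_0^∞ s e^{−(k−2)s} ds = 2π/(k − 2)²` (`Γ(2) = 1`). -/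
theorem phase_law_first_moment {k : ℝ} (hk : 2 < k) :
    2 * π * ∫ s in Ioi (0 : ℝ), s * Real.exp (-((k - 2) * s)) = 2 * π / (k - 2) ^ 2 := by
  have h := Real.integral_rpow_mul_exp_neg_mul_Ioi (a := 2) (r := k - 2) (by norm_num) (by linarith)
  have e : (fun t : ℝ => t ^ ((2 : ℝ) - 1) * Real.exp (-((k - 2) * t)))
      = fun t => t * Real.exp (-((k - 2) * t)) := by
    funext t
    rw [show (2 : ℝ) - 1 = 1 by norm_num, Real.rpow_one]
  rw [e] at h
  rw [h, Real.Gamma_two, show (2 : ℝ) = ((2 : ℕ) : ℝ) by norm_num, Real.rpow_natCast]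
  have hk2 : k - 2 ≠ 0 := by
    intro h0
    linarith
  field_simp

section measure

variable [MeasurableSpace Circle] [BorelSpace Circle]

/-! ### The law of the phase -/

/-- **THE LAW OF THE PHASE**: for continuous `F ≥ 0` on `[0, ∞)` with `F ∘ log|a|` `ν`-integrable,
`∫_G F(log|a(g)|) dν = 2π ∫_0^∞ F(s) e^{2s} ds`. -/
theorem integral_phase_eq {F : ℝ → ℝ} (hF : Continuous F) (hF0 : ∀ s, 0 ≤ s → 0 ≤ F s)
    (hint : Integrable (fun g => F (Real.log ‖mat g 0 0‖)) (nu haarCircle)) :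
    ∫ g, F (Real.log ‖mat g 0 0‖) ∂(nu haarCircle)
      = 2 * π * ∫ s in Ioi (0 : ℝ), F s * Real.exp (2 * s) := by
  rw [integral_nu_biRotInvariant hint fun u v g => by rw [norm_mat_rot_mul_rot], smul_eq_mul]
  congr 1
  have e1 : ∫ t in Ioi (0 : ℝ), (Real.sinh t * Real.cosh t) • F (Real.log ‖mat (hyp t) 0 0‖)
      = ∫ t in Ioi (0 : ℝ), Real.sinh t * Real.cosh t * F (Real.log (Real.cosh t)) := by
    refine setIntegral_congr_fun measurableSet_Ioi fun t ht => ?_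
    rw [smul_eq_mul, norm_mat_hyp (le_of_lt ht)]
  rw [e1]
  -- both integrands are non-negative on `(0, ∞)`: pass to lintegrals
  have hL : ∀ t, 0 < t → 0 ≤ Real.sinh t * Real.cosh t * F (Real.log (Real.cosh t)) := fun t ht =>
    mul_nonneg (mul_nonneg (Real.sinh_nonneg_iff.mpr ht.le) (Real.cosh_pos t).le)
      (hF0 _ (Real.log_nonneg (Real.one_le_cosh t)))
  have hR : ∀ s, 0 < s → 0 ≤ F s * Real.exp (2 * s) := fun s hs =>
    mul_nonneg (hF0 s hs.le) (Real.exp_pos _).le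
  have hLm : AEStronglyMeasurable (fun t => Real.sinh t * Real.cosh t * F (Real.log (Real.cosh t)))
      (volume.restrict (Ioi (0 : ℝ))) :=
    ((Real.continuous_sinh.mul Real.continuous_cosh).mul
      (hF.comp (Real.continuous_cosh.log fun t => (Real.cosh_pos t).ne'))).aestronglyMeasurable
  have hRm : AEStronglyMeasurable (fun s => F s * Real.exp (2 * s)) (volume.restrict (Ioi (0 : ℝ))) :=
    (hF.mul (Real.continuous_exp.comp (continuous_const.mul continuous_id))).aestronglyMeasurable
  rw [integral_eq_lintegral_of_nonneg_ae ((ae_restrict_iff' measurableSet_Ioi).mpr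
      (ae_of_all _ fun t ht => hL t ht)) hLm,
    integral_eq_lintegral_of_nonneg_ae ((ae_restrict_iff' measurableSet_Ioi).mpr
      (ae_of_all _ fun s hs => hR s hs)) hRm]
  congr 1
  rw [lintegral_Ioi_comp_log_cosh (fun s => ENNReal.ofReal (F s * Real.exp (2 * s)))]
  refine setLIntegral_congr_fun measurableSet_Ioi fun t ht => ?_
  rw [mem_Ioi] at ht
  have hc : 0 < Real.cosh t := Real.cosh_pos t
  have hsh : 0 < Real.sinh t := Real.sinh_pos_iff.mpr ht
  rw [abs_of_pos (div_pos hsh hc), ← ENNReal.ofReal_mul (div_pos hsh hc).le]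
  congr 1
  have e2 : Real.exp (2 * Real.log (Real.cosh t)) = Real.cosh t ^ 2 := by
    rw [show 2 * Real.log (Real.cosh t) = Real.log (Real.cosh t ^ 2) by
      rw [Real.log_pow]; push_cast; ring, Real.exp_log (by positivity)]
  rw [e2]
  field_simp

/-- **The tilted law**: under `(1 − |g·0|²)^{k/2} dν` the phase has density `2π e^{−(k−2)s}`:
`∫_G F(log|a(g)|) (1 − |g·0|²)^{k/2} dν = 2π ∫_0^∞ F(s) e^{−(k−2)s} ds` for continuous `F ≥ 0` on
`[0, ∞)` with an integrable left side. -/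
theorem integral_phase_mul_orbit_rpow {F : ℝ → ℝ} (hF : Continuous F) (hF0 : ∀ s, 0 ≤ s → 0 ≤ F s)
    (k : ℝ)
    (hint : Integrable (fun g => F (Real.log ‖mat g 0 0‖) * (1 - ‖orbit g‖ ^ 2) ^ (k / 2))
      (nu haarCircle)) :
    ∫ g, F (Real.log ‖mat g 0 0‖) * (1 - ‖orbit g‖ ^ 2) ^ (k / 2) ∂(nu haarCircle)
      = 2 * π * ∫ s in Ioi (0 : ℝ), F s * Real.exp (-((k - 2) * s)) := by
  have hG : Continuous fun s => F s * Real.exp (-(k * s)) :=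
    hF.mul (Real.continuous_exp.comp (continuous_const.mul continuous_id).neg)
  have hG0 : ∀ s, 0 ≤ s → 0 ≤ F s * Real.exp (-(k * s)) := fun s hs =>
    mul_nonneg (hF0 s hs) (Real.exp_pos _).le
  have e : ∀ g, F (Real.log ‖mat g 0 0‖) * (1 - ‖orbit g‖ ^ 2) ^ (k / 2)
      = F (Real.log ‖mat g 0 0‖) * Real.exp (-(k * Real.log ‖mat g 0 0‖)) := fun g => by
    rw [orbit_rpow_eq_exp]
  simp_rw [e] at hint ⊢
  rw [integral_phase_eq hG hG0 hint]
  congr 1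
  refine setIntegral_congr_fun measurableSet_Ioi fun s _ => ?_
  rw [mul_assoc, ← Real.exp_add]
  congr 2
  ring

/-! ### Cross-checks -/

/-- The law reproduces `∫_G (1 − |g·0|²)^{k/2} dν = 2π/(k − 2)` (`T5SU11JacobiIwasawa.integral_orbit_rpow_nu`)
through `F ≡ 1`. -/
theorem phase_law_check_mass {k : ℝ} (hk : 2 < k) :
    2 * π * ∫ s in Ioi (0 : ℝ), Real.exp (-((k - 2) * s))
      = ∫ g, (1 - ‖orbit g‖ ^ 2) ^ (k / 2) ∂(nu haarCircle) := by
  have hint : Integrable (fun g => (1 : ℝ) * (1 - ‖orbit g‖ ^ 2) ^ (k / 2)) (nu haarCircle) := by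
    have := integrable_orbit_rpow_mul_sph (lam := 0) (by linarith) (by linarith) (by linarith)
    refine this.congr (Filter.Eventually.of_forall fun g => ?_)
    simp [sph_zero]
  have h := integral_phase_mul_orbit_rpow (F := fun _ => 1) continuous_const (fun _ _ => zero_le_one)
    k hint
  simp only [one_mul] at h
  exact h.symm

/-- The law reproduces the first moment `∫_G log|a(g)| (1 − |g·0|²)^{k/2} dν = 2π/(k − 2)²` of the
derivative formula (`T5SU11JacobiWeightDeriv`, at `λ = 0`) through `F(s) = s`. -/
theorem phase_law_check_first_moment {k : ℝ} (hk : 2 < k) :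
    ∫ g, Real.log ‖mat g 0 0‖ * (1 - ‖orbit g‖ ^ 2) ^ (k / 2) ∂(nu haarCircle) = 2 * π / (k - 2) ^ 2 := by
  have hint : Integrable (fun g => Real.log ‖mat g 0 0‖ * (1 - ‖orbit g‖ ^ 2) ^ (k / 2))
      (nu haarCircle) := by
    have := integrable_log_norm_mat_mul_orbit_rpow_mul_sph (lam := 0) (by linarith) (by linarith)
      (by linarith)
    simpa only [sph_zero, mul_one] using this
  have h := integral_phase_mul_orbit_rpow (F := fun s => s) continuous_id' (fun s hs => hs) k hint
  exact h.trans (phase_law_first_moment hk)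

end measure

end Summit.Ventures.HodgeRepro2.T5SU11PhaseLaw
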